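import Mathlib.Data.Fintype.Card
import Mathlib.Data.Fintype.Prod
import Literature.Computability.AlgebraicComplexity.MatrixMultiplicationExponent
import HarnessLib

/-!
# Term types of the Brent equations and the pigeonhole on type-3 terms
# (Heule–Kauers–Seidl, SAT 2019, §2)

Topic `Literature/Computability/AlgebraicComplexity`, in the tree's coordinates
(`MatrixMultiplicationExponent.lean`: `triad w u v = w ⊗ u ⊗ v`, `matMulTensor K k m n = ⟨k,m,n⟩`
with slots `(Z_{κν}, X_{κμ}, Y_{μν})`). Source: M. J. H. Heule, M. Kauers, M. Seidl, *Local Search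
for Fast Matrix Multiplication*, SAT 2019, LNCS 11628, 155–163 = arXiv:1903.11391 (HKS19), §2:
"We found it convenient to say that a term `a_{i₁i₂} b_{j₁j₂} c_{k₁k₂}` has “type `m`” if
`m = δ_{i₂j₁} + δ_{j₂k₁} + δ_{k₂i₁}`. With this terminology, all terms of types 0, 1, 2 have to
cancel each other, and all terms of type 3 have to survive. Note that since all 27 type 3 terms
must be produced by the 23 summands on the left, some summands must produce more than one type 3
term."  Everything here is PROVED, for every format `⟨k,m,n⟩` over any non-trivial commutative
ring; no named facts.

Dictionary. HKS expand `Σ_ℓ (Σ α^{(ℓ)}_{i₁i₂} a_{i₁i₂})(Σ β^{(ℓ)}_{j₁j₂} b_{j₁j₂})(Σ γ^{(ℓ)}_{k₁k₂} c_{k₁k₂})`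
"with the indices of `γ` flipped"; a term is an index triple, in the tree a triple
`(a, b, c) ∈ (Fin k × Fin n) × (Fin k × Fin m) × (Fin m × Fin n)` of positions of the three slots
(`a` = the flipped `γ`-index = the tree's `Z`-slot, `b` = `α`'s index = `X`, `c` = `β`'s = `Y`), and
its three Kronecker deltas are the three conditions `a.1 = b.1`, `b.2 = c.1`, `a.2 = c.2` of
`matMulTensor` (`matMulTensor_eq_ite_termType`). "Summand `ℓ` produces the term" = the coefficient
`w_ℓ(a) u_ℓ(b) v_ℓ(c)` of that term in the expansion of the `ℓ`-th product is non-zero.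

## What is typed

* `termType a b c ∈ {0,1,2,3}` — HKS's type `m` (`termType_le_three`);
  `matMulTensor_eq_ite_termType` — the right-hand side of the Brent equation at `(a,b,c)` is `1`
  iff the term has type `3` ("flipped" convention = the tree's).
* `heuleKauersSeidl2019_types_cancel` — "all terms of types 0, 1, 2 have to cancel each other":
  at a term of type `≠ 3` the coefficients of a decomposition sum to `0`;
  `heuleKauersSeidl2019_type3_survive` — "all terms of type 3 have to survive": they sum to `1`,
  hence (`heuleKauersSeidl2019_type3_produced`) some summand produces each type-3 term.
* `card_type3` — there are `k·m·n` type-3 terms ("all 27 type 3 terms" for `3 × 3`).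
* **`heuleKauersSeidl2019_exists_summand_two_type3`** — the printed pigeonhole for every format:
  a decomposition of `⟨k,m,n⟩` with fewer than `k·m·n` summands has a summand producing two
  different type-3 terms; `heuleKauersSeidl2019_exists_summand_two_type3_333` — the printed
  instance (`27` type-3 terms, `23` summands).

## References

* M. J. H. Heule, M. Kauers, M. Seidl, *Local Search for Fast Matrix Multiplication*, Proc. SAT
  2019, LNCS 11628, 155–163, doi:10.1007/978-3-030-24258-9_10, arXiv:1903.11391, §2 (term types;
  the pigeonhole sentence). [HeuleKauersSeidl2019]
* M. Bläser, *Fast Matrix Multiplication*, Theory of Computing Graduate Surveys 5 (2013), §5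
  (the tensor `⟨k,m,n⟩`). [Blaser2013]
-/

namespace Literature.Computability.AlgebraicComplexity

open scoped BigOperators

namespace BrentTermTypes

variable {k m n : ℕ}

/-- **HKS19 §2, the type of a term:** "a term `a_{i₁i₂} b_{j₁j₂} c_{k₁k₂}` has “type `m`” if
`m = δ_{i₂j₁} + δ_{j₂k₁} + δ_{k₂i₁}`" — in the tree's slots the number of the three index
coincidences `a.1 = b.1` (row of `Z` = row of `X`), `b.2 = c.1` (column of `X` = row of `Y`),
`a.2 = c.2` (column of `Z` = column of `Y`). [cite: HeuleKauersSeidl2019, §2 (type of a term)] -/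
def termType (a : Fin k × Fin n) (b : Fin k × Fin m) (c : Fin m × Fin n) : ℕ :=
  (if a.1 = b.1 then 1 else 0) + (if b.2 = c.1 then 1 else 0) + (if a.2 = c.2 then 1 else 0)

/-- A type is at most `3`. [cite: HeuleKauersSeidl2019, §2 (types 0, 1, 2, 3)] -/
theorem termType_le_three (a : Fin k × Fin n) (b : Fin k × Fin m) (c : Fin m × Fin n) :
    termType a b c ≤ 3 := by
  unfold termType
  split_ifs <;> omega

/-- A term has type `3` iff all three index coincidences hold.
[cite: HeuleKauersSeidl2019, §2 (type of a term)] -/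
theorem termType_eq_three_iff (a : Fin k × Fin n) (b : Fin k × Fin m) (c : Fin m × Fin n) :
    termType a b c = 3 ↔ a.1 = b.1 ∧ b.2 = c.1 ∧ a.2 = c.2 := by
  unfold termType
  split_ifs <;> simp_all

/-- **The right-hand side of the Brent equations in terms of types** ("the indices of `γ` flipped,
as agreed"): the coefficient of the term `(a,b,c)` in `⟨k,m,n⟩` is `1` for type `3` and `0` for
types `0, 1, 2`. [cite: HeuleKauersSeidl2019, §2 ("all terms of types 0, 1, 2 have to cancel …
all terms of type 3 have to survive")] -/
theorem matMulTensor_eq_ite_termType (K : Type*) [CommSemiring K] (a : Fin k × Fin n)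
    (b : Fin k × Fin m) (c : Fin m × Fin n) :
    matMulTensor K k m n a b c = if termType a b c = 3 then 1 else 0 := by
  by_cases h : a.1 = b.1 ∧ b.2 = c.1 ∧ a.2 = c.2
  · rw [if_pos ((termType_eq_three_iff a b c).2 h)]
    simp [matMulTensor, h]
  · rw [if_neg (fun h3 => h ((termType_eq_three_iff a b c).1 h3))]
    simp [matMulTensor, h]

variable {K : Type*} [CommRing K] {σ : Type*} [Fintype σ]
  {w : σ → Fin k × Fin n → K} {u : σ → Fin k × Fin m → K} {v : σ → Fin m × Fin n → K}

/-- The coefficient of the term `(a,b,c)` in the expansion of `Σ_ρ w_ρ ⊗ u_ρ ⊗ v_ρ` is the sum of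
the coefficients `w_ρ(a) u_ρ(b) v_ρ(c)` produced by the summands. [cite: HeuleKauersSeidl2019, §2
("Expanding the left hand side and equating coefficients leads to the Brent equations")] -/
theorem sum_triad_apply (a : Fin k × Fin n) (b : Fin k × Fin m) (c : Fin m × Fin n) :
    (∑ ρ, triad (w ρ) (u ρ) (v ρ)) a b c = ∑ ρ, w ρ a * u ρ b * v ρ c := by
  simp only [Finset.sum_apply, triad_apply]

/-- **"All terms of types 0, 1, 2 have to cancel each other":** at a term of type `≠ 3` the
coefficients produced by the summands of a decomposition of `⟨k,m,n⟩` sum to `0`.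
[cite: HeuleKauersSeidl2019, §2] -/
theorem heuleKauersSeidl2019_types_cancel (ht : matMulTensor K k m n = ∑ ρ, triad (w ρ) (u ρ) (v ρ))
    {a : Fin k × Fin n} {b : Fin k × Fin m} {c : Fin m × Fin n} (h : termType a b c ≠ 3) :
    ∑ ρ, w ρ a * u ρ b * v ρ c = 0 := by
  rw [← sum_triad_apply, ← ht, matMulTensor_eq_ite_termType, if_neg h]

/-- **"All terms of type 3 have to survive":** at a term of type `3` the coefficients sum to `1`.
[cite: HeuleKauersSeidl2019, §2] -/
theorem heuleKauersSeidl2019_type3_survive (ht : matMulTensor K k m n = ∑ ρ, triad (w ρ) (u ρ) (v ρ))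
    {a : Fin k × Fin n} {b : Fin k × Fin m} {c : Fin m × Fin n} (h : termType a b c = 3) :
    ∑ ρ, w ρ a * u ρ b * v ρ c = 1 := by
  rw [← sum_triad_apply, ← ht, matMulTensor_eq_ite_termType, if_pos h]

/-- **Hence every type-3 term "must be produced by" some summand** (over a non-trivial ring): some
`ρ` has a non-zero coefficient `w_ρ(a) u_ρ(b) v_ρ(c)` at it.
[cite: HeuleKauersSeidl2019, §2 ("all 27 type 3 terms must be produced by the 23 summands")] -/
theorem heuleKauersSeidl2019_type3_produced [Nontrivial K]
    (ht : matMulTensor K k m n = ∑ ρ, triad (w ρ) (u ρ) (v ρ))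
    {a : Fin k × Fin n} {b : Fin k × Fin m} {c : Fin m × Fin n} (h : termType a b c = 3) :
    ∃ ρ, w ρ a * u ρ b * v ρ c ≠ 0 := by
  by_contra hne
  push Not at hne
  have hs := heuleKauersSeidl2019_type3_survive ht h
  rw [Finset.sum_eq_zero fun ρ _ => hne ρ] at hs
  exact zero_ne_one hs

/-- The type-3 terms are indexed by the triples `(κ, μ, ν)`: the term
`(Z_{κν}, X_{κμ}, Y_{μν})`. [cite: HeuleKauersSeidl2019, §2 ("all 27 type 3 terms")] -/
def type3Term (q : Fin k × Fin m × Fin n) :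
    (Fin k × Fin n) × (Fin k × Fin m) × (Fin m × Fin n) :=
  ((q.1, q.2.2), (q.1, q.2.1), (q.2.1, q.2.2))

/-- These terms have type `3`. [cite: HeuleKauersSeidl2019, §2] -/
theorem termType_type3Term (q : Fin k × Fin m × Fin n) :
    termType (type3Term q).1 (type3Term q).2.1 (type3Term q).2.2 = 3 :=
  (termType_eq_three_iff _ _ _).2 ⟨rfl, rfl, rfl⟩

/-- … they are pairwise distinct … [cite: HeuleKauersSeidl2019, §2] -/
theorem type3Term_injective : Function.Injective (type3Term (k := k) (m := m) (n := n)) := by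
  rintro ⟨κ, μ, ν⟩ ⟨κ', μ', ν'⟩ h
  simp only [type3Term, Prod.mk.injEq] at h
  obtain ⟨⟨rfl, rfl⟩, ⟨-, rfl⟩, -⟩ := h
  rfl

/-- … and every type-3 term is one of them. [cite: HeuleKauersSeidl2019, §2] -/
theorem exists_type3Term_of_termType_eq {a : Fin k × Fin n} {b : Fin k × Fin m} {c : Fin m × Fin n}
    (h : termType a b c = 3) : ∃ q, type3Term q = (a, b, c) := by
  obtain ⟨h1, h2, h3⟩ := (termType_eq_three_iff a b c).1 h
  refine ⟨(a.1, b.2, a.2), ?_⟩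
  obtain ⟨a₁, a₂⟩ := a
  obtain ⟨b₁, b₂⟩ := b
  obtain ⟨c₁, c₂⟩ := c
  simp only at h1 h2 h3
  subst h1 h2 h3
  rfl

/-- **"All 27 type 3 terms":** `⟨k,m,n⟩` has exactly `k·m·n` terms of type `3` (for `3 × 3`
matrices, `27`). [cite: HeuleKauersSeidl2019, §2 ("all 27 type 3 terms")] -/
theorem card_type3 :
    (Finset.univ.filter fun p : (Fin k × Fin n) × (Fin k × Fin m) × (Fin m × Fin n) =>
      termType p.1 p.2.1 p.2.2 = 3).card = k * m * n := by
  classical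
  have e : (Finset.univ.filter fun p : (Fin k × Fin n) × (Fin k × Fin m) × (Fin m × Fin n) =>
      termType p.1 p.2.1 p.2.2 = 3) = Finset.univ.map ⟨type3Term, type3Term_injective⟩ := by
    ext p
    simp only [Finset.mem_filter, Finset.mem_univ, true_and, Finset.mem_map,
      Function.Embedding.coeFn_mk]
    constructor
    · intro h
      obtain ⟨q, hq⟩ := exists_type3Term_of_termType_eq (a := p.1) (b := p.2.1) (c := p.2.2) h
      exact ⟨q, hq⟩
    · rintro ⟨q, rfl⟩
      exact termType_type3Term q
  rw [e, Finset.card_map, Finset.card_univ, Fintype.card_prod, Fintype.card_prod, Fintype.card_fin,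
    Fintype.card_fin, Fintype.card_fin, mul_assoc]

/-- **HKS19 §2: "since all 27 type 3 terms must be produced by the 23 summands on the left, some
summands must produce more than one type 3 term"** — for every format and every non-trivial
commutative ring: a decomposition of `⟨k,m,n⟩` into fewer than `k·m·n` summands has a summand
`ρ` producing two different type-3 terms. [cite: HeuleKauersSeidl2019, §2] -/
theorem heuleKauersSeidl2019_exists_summand_two_type3 [Nontrivial K]
    (ht : matMulTensor K k m n = ∑ ρ, triad (w ρ) (u ρ) (v ρ)) (hcard : Fintype.card σ < k * m * n) :
    ∃ (ρ : σ) (a a' : Fin k × Fin n) (b b' : Fin k × Fin m) (c c' : Fin m × Fin n),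
      (a, b, c) ≠ (a', b', c') ∧ termType a b c = 3 ∧ termType a' b' c' = 3 ∧
      w ρ a * u ρ b * v ρ c ≠ 0 ∧ w ρ a' * u ρ b' * v ρ c' ≠ 0 := by
  classical
  -- choose, for every type-3 term, a summand producing it
  choose f hf using fun q : Fin k × Fin m × Fin n =>
    heuleKauersSeidl2019_type3_produced ht (termType_type3Term q)
  -- there are more type-3 terms than summands
  have hlt : Fintype.card σ < Fintype.card (Fin k × Fin m × Fin n) := by
    simpa [Fintype.card_prod, mul_assoc] using hcard
  obtain ⟨q, q', hqq', hfq⟩ := Fintype.exists_ne_map_eq_of_card_lt f hlt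
  refine ⟨f q, (type3Term q).1, (type3Term q').1, (type3Term q).2.1, (type3Term q').2.1,
    (type3Term q).2.2, (type3Term q').2.2, fun h => hqq' (type3Term_injective ?_),
    termType_type3Term q, termType_type3Term q', hf q, hfq ▸ hf q'⟩
  exact Prod.ext (Prod.mk.inj h).1 (Prod.mk.inj h).2

/-- **The printed instance:** every scheme for `3 × 3` matrices with `23` products (indeed with any
number `r ≤ 26` of products), over any non-trivial commutative ring, has a product producing two
different type-3 terms ("some summands must produce more than one type 3 term").
[cite: HeuleKauersSeidl2019, §2] -/
theorem heuleKauersSeidl2019_exists_summand_two_type3_333 [Nontrivial K] {r : ℕ} (hr : r ≤ 26)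
    {w : Fin r → Fin 3 × Fin 3 → K} {u : Fin r → Fin 3 × Fin 3 → K} {v : Fin r → Fin 3 × Fin 3 → K}
    (ht : matMulTensor K 3 3 3 = ∑ ρ, triad (w ρ) (u ρ) (v ρ)) :
    ∃ (ρ : Fin r) (a a' b b' c c' : Fin 3 × Fin 3),
      (a, b, c) ≠ (a', b', c') ∧ termType a b c = 3 ∧ termType a' b' c' = 3 ∧
      w ρ a * u ρ b * v ρ c ≠ 0 ∧ w ρ a' * u ρ b' * v ρ c' ≠ 0 :=
  heuleKauersSeidl2019_exists_summand_two_type3 ht (by rw [Fintype.card_fin]; omega)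

end BrentTermTypes

end Literature.Computability.AlgebraicComplexity
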